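import Literature.AlgebraicGeometry.Motives.GeneratingSectionsOfCocycle
import HarnessLib

/-!
# Generating sections of a trivialised line bundle: compatibility with pull-back

[cite: Hartshorne1977, Chapter II, Theorem 7.1 and its proof]
[cite: GortzWedhorn2020, (13.8) and Proposition 11.15]

Let `h : T → X` be a morphism of schemes and let `S : CocycleSections ι W` be the coefficients of
global sections `t_i` of a line bundle `𝓛` on `X` trivialised on the opens `W a`
(`Literature.AlgebraicGeometry.Motives.GeneratingSections.CocycleSections`). The pulled-back line
bundle `h^*𝓛` is trivialised on the `h⁻¹(W a)` and its sections `h^* t_i` have the coefficients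
`h^*(c i a)`; we record this as `CocycleSections.comap h S` and prove that the generating-sections
datum it defines IS the pull-back datum of Hartshorne II Thm. 7.1 (the morphism to `ℙⁿ` defined by
`(h^*𝓛, h^*t_i)` is the composite `T → X → ℙⁿ`):

`ofCocycleSections (h⁻¹ W) (S.comap h) _ = (ofCocycleSections W S hcov).comap h`

(`GeneratingSections.ofCocycleSections_comap`), an equality of `GeneratingSections ι T`; in
particular the opens are `h⁻¹(X_{t_i})` and the ratios are `h^*(t_j/t_i)`, so
`GeneratingSections.comap_toProj` computes the morphism to projective space of the pulled-back
sections. The proof is the uniqueness of the glued ratio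
(`GeneratingSections.ofCocycleSections_ratio_unique`) together with a general extensionality
principle for generating-sections data (`GeneratingSections.eq_of_U_eq`). Elementary
sheaf-of-rings bookkeeping; the citations locate the statement in print.
-/

open CategoryTheory Opposite TopologicalSpace AlgebraicGeometry

universe v u

noncomputable section

namespace Literature.AlgebraicGeometry.Motives

namespace GeneratingSections

variable {ι : Type} {α : Type v} {X T : Scheme.{u}} (h : T ⟶ X)

/-! ### Extensionality of generating-sections data -/

omit h in
/-- **Extensionality**: two generating-sections data with the same opens and the same ratios (after
the transport of opens) are equal (the datum `(U i, s_j/s_i)` of Hartshorne II Thm. 7.1 has no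
further content). [cite: Hartshorne1977, II Thm. 7.1] -/
theorem eq_of_U_eq {D₁ D₂ : GeneratingSections ι T} (hU : ∀ i, D₁.U i = D₂.U i)
    (hr : ∀ i j, D₁.ratio i j = T.presheaf.map (eqToHom (hU i)).op (D₂.ratio i j)) : D₁ = D₂ := by
  obtain ⟨U₁, hc₁, r₁, hs₁, hb₁, hm₁⟩ := D₁
  obtain ⟨U₂, hc₂, r₂, hs₂, hb₂, hm₂⟩ := D₂
  obtain rfl : U₁ = U₂ := funext hU
  have hr' : r₁ = r₂ := by
    funext i j
    have := hr i j
    simp only [eqToHom_refl, op_id, CategoryTheory.Functor.map_id] at this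
    exact this
  subst hr'
  rfl

/-! ### Pulling back the coefficients -/

omit h in
/-- Two parallel restriction maps of `𝒪_T` agree (the category of opens is thin). [folklore] -/
private theorem map_irrel {A B : T.Opens} (f g : op A ⟶ op B) (x : Γ(T, A)) :
    T.presheaf.map f x = T.presheaf.map g x := by
  have : f = g := congrArg Quiver.Hom.op (Subsingleton.elim f.unop g.unop)
  rw [this]

omit h in
/-- Two-step restriction of `𝒪_T` equals any one-step restriction with the same ends. [folklore] -/
private theorem map_map_eq {A B C : T.Opens} (f : op A ⟶ op B) (g : op B ⟶ op C) (k : op A ⟶ op C)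
    (x : Γ(T, A)) : T.presheaf.map g (T.presheaf.map f x) = T.presheaf.map k x := by
  rw [← CommRingCat.comp_apply, ← Functor.map_comp]
  exact map_irrel _ _ _

/-- Restriction after pull-back is pull-back (`appLE`) after restriction (naturality of `h^*`,
elementwise). [folklore] -/
private theorem map_app_eq {U V : X.Opens} {W' : T.Opens} (eVU : V ≤ U) (eW : W' ≤ h ⁻¹ᵁ V)
    (eW' : W' ≤ h ⁻¹ᵁ U) (r : Γ(X, U)) :
    T.presheaf.map (homOfLE eW').op (h.app U r) =
      h.appLE V W' eW (X.presheaf.map (homOfLE eVU).op r) := by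
  have h1 : h.app U ≫ T.presheaf.map (homOfLE eW').op =
      X.presheaf.map (homOfLE eVU).op ≫ h.appLE V W' eW := by
    rw [Scheme.Hom.app_eq_appLE, Scheme.Hom.appLE_map, Scheme.Hom.map_appLE]
  have h2 := ConcreteCategory.congr_hom h1 r
  rwa [CommRingCat.comp_apply, CommRingCat.comp_apply] at h2

namespace CocycleSections

variable {W : α → X.Opens} (S : CocycleSections ι W)

/-- `T_{h^* c i a} = h⁻¹(X_{c i a})`. [cite: Hartshorne1977, II Thm. 7.1] -/
theorem basicOpen_comap_coeff (i : ι) (a : α) :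
    T.basicOpen ((S.comap h).coeff i a) = h ⁻¹ᵁ X.basicOpen (S.coeff i a) := by
  rw [comap_coeff, Scheme.preimage_basicOpen]

/-- If the `X_{c i a}` cover `X`, the `T_{h^* c i a}` cover `T` (generation pulls back).
[cite: Hartshorne1977, II Thm. 7.1] -/
theorem iSup_basicOpen_comap_coeff (hcov : ⨆ i, ⨆ a, X.basicOpen (S.coeff i a) = ⊤) :
    ⨆ i, ⨆ a, T.basicOpen ((S.comap h).coeff i a) = ⊤ := by
  simp_rw [basicOpen_comap_coeff, ← Scheme.Hom.preimage_iSup, hcov]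
  rfl

end CocycleSections

/-! ### The generating-sections datum of the pulled-back coefficients is the pulled-back datum -/

variable {W : α → X.Opens} (S : CocycleSections ι W)
  (hcov : ⨆ i, ⨆ a, X.basicOpen (S.coeff i a) = ⊤)

/-- The opens agree: `⋃_a T_{h^* c i a} = h⁻¹(⋃_a X_{c i a})`. [cite: Hartshorne1977, II Thm. 7.1] -/
theorem ofCocycleSections_comap_U (i : ι) :
    (ofCocycleSections (fun a => h ⁻¹ᵁ W a) (S.comap h)
        (CocycleSections.iSup_basicOpen_comap_coeff h S hcov)).U i =
      ((ofCocycleSections W S hcov).comap h).U i := by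
  rw [ofCocycleSections_U, comap_U, ofCocycleSections_U, Scheme.Hom.preimage_iSup]
  simp_rw [CocycleSections.basicOpen_comap_coeff]

/-- The ratios agree: the glued ratio of the pulled-back coefficients is `h^*(t_j/t_i)` (transported
along `ofCocycleSections_comap_U`). [cite: Hartshorne1977, II Thm. 7.1] -/
theorem ofCocycleSections_comap_ratio (i j : ι) :
    (ofCocycleSections (fun a => h ⁻¹ᵁ W a) (S.comap h)
        (CocycleSections.iSup_basicOpen_comap_coeff h S hcov)).ratio i j =
      T.presheaf.map (eqToHom (ofCocycleSections_comap_U h S hcov i)).op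
        (((ofCocycleSections W S hcov).comap h).ratio i j) := by
  symm
  refine ofCocycleSections_ratio_unique (fun a => h ⁻¹ᵁ W a) (S.comap h)
    (CocycleSections.iSup_basicOpen_comap_coeff h S hcov) i j _ fun a => ?_
  -- abbreviations
  have eD : T.basicOpen ((S.comap h).coeff i a) ≤ h ⁻¹ᵁ X.basicOpen (S.coeff i a) :=
    (CocycleSections.basicOpen_comap_coeff h S i a).le
  have eDU : T.basicOpen ((S.comap h).coeff i a) ≤ h ⁻¹ᵁ (ofCocycleSections W S hcov).U i :=
    eD.trans (h.preimage_mono (basicOpen_le_ofCocycleSections_U W S hcov i a))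
  have eDW : T.basicOpen ((S.comap h).coeff i a) ≤ h ⁻¹ᵁ W a :=
    eD.trans (h.preimage_mono (X.basicOpen_le _))
  -- the transported, restricted pulled-back ratio is `appLE` of the restricted ratio
  have h1 : T.presheaf.map
        (homOfLE (basicOpen_le_ofCocycleSections_U (fun a => h ⁻¹ᵁ W a) (S.comap h)
          (CocycleSections.iSup_basicOpen_comap_coeff h S hcov) i a)).op
        (T.presheaf.map (eqToHom (ofCocycleSections_comap_U h S hcov i)).op
          (((ofCocycleSections W S hcov).comap h).ratio i j)) =
      h.appLE (X.basicOpen (S.coeff i a)) (T.basicOpen ((S.comap h).coeff i a)) eD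
        (X.presheaf.map (homOfLE (basicOpen_le_ofCocycleSections_U W S hcov i a)).op
          ((ofCocycleSections W S hcov).ratio i j)) := by
    refine (map_map_eq _ _ (homOfLE eDU).op _).trans ?_
    rw [comap_ratio, map_app_eq h _ eD eDU]
  have h2 : ∀ k, T.presheaf.map (homOfLE (T.basicOpen_le ((S.comap h).coeff i a))).op
        ((S.comap h).coeff k a) =
      h.appLE (X.basicOpen (S.coeff i a)) (T.basicOpen ((S.comap h).coeff i a)) eD
        (X.presheaf.map (homOfLE (X.basicOpen_le (S.coeff i a))).op (S.coeff k a)) := fun k => by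
    change T.presheaf.map (homOfLE (T.basicOpen_le ((S.comap h).coeff i a))).op
      (h.app (W a) (S.coeff k a)) = _
    rw [map_irrel _ (homOfLE eDW).op, map_app_eq h _ eD eDW]
  rw [h1, h2 i, h2 j, ← map_mul, ofCocycleSections_ratio_res_mul]

/-- **Generating sections of a trivialised line bundle commute with pull-back** (Hartshorne II
Thm. 7.1: the morphism to `ℙⁿ` defined by `(h^*𝓛, h^*t_i)` is `T → X → ℙⁿ`): the datum of the
pulled-back coefficients IS the pulled-back datum `GeneratingSections.comap`.
[cite: Hartshorne1977, II Thm. 7.1] [cite: GortzWedhorn2020, (13.8)] -/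
theorem ofCocycleSections_comap :
    ofCocycleSections (fun a => h ⁻¹ᵁ W a) (S.comap h)
        (CocycleSections.iSup_basicOpen_comap_coeff h S hcov) =
      (ofCocycleSections W S hcov).comap h :=
  eq_of_U_eq (ofCocycleSections_comap_U h S hcov) (ofCocycleSections_comap_ratio h S hcov)

/-- Hence the morphisms to projective space agree: `toProj` of the pulled-back coefficients over a
base `Spec k` is `h ≫ toProj` (★ `GeneratingSections.comap_toProj`).
[cite: Hartshorne1977, II Thm. 7.1] -/
theorem toProj_ofCocycleSections_comap {k : Type u} [CommRing k] (f : X ⟶ Spec (.of k)) :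
    (ofCocycleSections (fun a => h ⁻¹ᵁ W a) (S.comap h)
        (CocycleSections.iSup_basicOpen_comap_coeff h S hcov)).toProj (h ≫ f) =
      h ≫ (ofCocycleSections W S hcov).toProj f := by
  rw [ofCocycleSections_comap, comap_toProj]

end GeneratingSections

end Literature.AlgebraicGeometry.Motives
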